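import Literature.AnabelianGeometry.AbsoluteAnabelian.ProfiniteTerminology
import Mathlib.GroupTheory.GroupAction.ConjAct
import Mathlib.GroupTheory.Index
import Mathlib.Topology.Algebra.Group.ClosedSubgroup
import HarnessLib

/-!
# [AbsTopI] §0: a slim group has no nontrivial finite normal subgroups — PROVED

S. Mochizuki, *Topics in Absolute Anabelian Geometry I: Generalities* (2012) [AbsTopI], §0
"Topological Groups" p. 8 (manuscript pagination, lit key paper:url-11ac98ba15fc): "We shall say
that a profinite group `G` is slim if for every open subgroup `H ⊆ G`, the centralizer `Z_G(H)`
is trivial.  Note that every finite normal closed subgroup `N ⊆ G` of a slim profinite group `G`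
is trivial.  [Indeed, this follows by observing that for any normal open subgroup `H ⊆ G` such
that `N ∩ H = {1}`, consideration of the inclusion `N ↪ G/H` reveals that the conjugation action
of `H` on `N` is trivial, i.e., that `N ⊆ Z_G(H) = {1}`.]"  The remark is used, e.g., in the proof
of [AbsTopI] Thm 1.7 (ii) (p. 14: "Since `Q` has already been shown to be slim [hence has no
nontrivial finite normal closed subgroups — cf. §0], we may always replace `k` by a finite
extension of `k`") and was recorded as "provable; left for a later pass" in the module docstring of
`ProfiniteTerminology.lean` (abc-iut-L4-t1).

PROVED here for an arbitrary HAUSDORFF topological group (no profiniteness needed) with the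
tree's predicate `Literature.AlgebraicGeometry.Frobenioids.IsSlimGroup` ([FrdI] §0 = [AbsAnab]
Def 0.1 (i) = [AbsTopI] §0): the centralizer `C := Z_G(N)` of a finite normal subgroup `N` is the
intersection of the finitely many point-centralizers `Z_G(n)`, `n ∈ N`, each CLOSED (Hausdorff)
and of FINITE INDEX (its index is the size of the conjugacy class of `n`, which lies in the finite
normal subgroup `N`); hence `C` is a closed subgroup of finite index, i.e. OPEN, and `N ⊆ Z_G(C)`,
which is trivial by slimness.  (This is the printed argument with `H := Z_G(N)`.)

HONEST FRAMING: an elementary remark of a refereed, undisputed paper; nothing here bears on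
[IUTchIII] Cor. 3.12.
-/

namespace Literature.AnabelianGeometry.AbsoluteAnabelian

open Literature.AlgebraicGeometry.Frobenioids (IsSlimGroup)
open scoped Pointwise

universe u

variable {G : Type u} [Group G] [TopologicalSpace G] [IsTopologicalGroup G] [T2Space G]

/-- In a Hausdorff topological group, the centralizer of a single element is closed.
[cite: MochizukiAbsTopI2012, §0 p.8] -/
private theorem isClosed_centralizer_singleton (n : G) :
    IsClosed ((Subgroup.centralizer ({n} : Set G) : Subgroup G) : Set G) := by
  have h : ((Subgroup.centralizer ({n} : Set G) : Subgroup G) : Set G) =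
      {g : G | g * n = n * g} := by
    ext g
    simp [Subgroup.mem_centralizer_iff, eq_comm]
  rw [h]
  exact isClosed_eq (continuous_id.mul continuous_const) (continuous_const.mul continuous_id)

omit [TopologicalSpace G] [IsTopologicalGroup G] [T2Space G] in
/-- The centralizer of an element `n` of a FINITE NORMAL subgroup `N` has finite index: it is the
stabilizer of `n` for the conjugation action, whose orbit (the conjugacy class of `n`) lies in
`N`. [cite: MochizukiAbsTopI2012, §0 p.8] -/
private theorem finiteIndex_centralizer_singleton_of_mem (N : Subgroup G) [N.Normal]
    (hN : (N : Set G).Finite) {n : G} (hn : n ∈ N) :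
    (Subgroup.centralizer ({n} : Set G) : Subgroup G).FiniteIndex := by
  rw [Subgroup.centralizer_eq_comap_stabilizer]
  -- the orbit (= conjugacy class of `n`) is contained in `N`, hence finite and nonempty
  have horb : MulAction.orbit (ConjAct G) n ⊆ (N : Set G) := by
    rintro _ ⟨g, rfl⟩
    show g • n ∈ (N : Set G)
    rw [ConjAct.smul_def]
    exact ‹N.Normal›.conj_mem n hn _
  have hpos : 0 < (MulAction.orbit (ConjAct G) n).ncard :=
    (Set.ncard_pos (hN.subset horb)).mpr ⟨n, MulAction.mem_orbit_self n⟩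
  refine ⟨fun h0 => ?_⟩
  erw [Subgroup.index_comap_of_surjective _ ConjAct.toConjAct.surjective,
    MulAction.index_stabilizer] at h0
  omega

/-- **[AbsTopI] §0 p. 8: a slim group has no nontrivial finite normal subgroups** — "every finite
normal closed subgroup `N ⊆ G` of a slim profinite group `G` is trivial", PROVED for every
Hausdorff topological group `G` satisfying the tree's `IsSlimGroup` (centralizers of open
subgroups trivial); finiteness makes closedness automatic, so it is not assumed.
[cite: MochizukiAbsTopI2012, §0 p.8] -/
theorem eq_bot_of_finite_normal_of_isSlimGroup (hG : IsSlimGroup G) (N : Subgroup G) [N.Normal]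
    (hN : (N : Set G).Finite) : N = ⊥ := by
  classical
  -- `C := Z_G(N) = ⋂_{n ∈ N} Z_G(n)` is closed and of finite index, hence open
  haveI : Finite N := hN.to_subtype
  let C : Subgroup G := ⨅ n : N, Subgroup.centralizer ({(n : G)} : Set G)
  have hCc : IsClosed (C : Set G) := by
    have : (C : Set G) =
        ⋂ n : N, ((Subgroup.centralizer ({(n : G)} : Set G) : Subgroup G) : Set G) := by
      simp [C, Subgroup.coe_iInf]
    rw [this]
    exact isClosed_iInter fun n => isClosed_centralizer_singleton (n : G)
  haveI hCfi : C.FiniteIndex := by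
    haveI : ∀ n : N, (Subgroup.centralizer ({(n : G)} : Set G) : Subgroup G).FiniteIndex :=
      fun n => finiteIndex_centralizer_singleton_of_mem N hN n.2
    exact Subgroup.finiteIndex_iInf fun n => inferInstance
  have hCo : IsOpen (C : Set G) := Subgroup.isOpen_of_isClosed_of_finiteIndex C hCc
  -- `N ⊆ Z_G(C) = 1`
  have hZ := hG.centralizer_eq_bot C hCo
  rw [eq_bot_iff]
  intro n hn
  have hmem : n ∈ Subgroup.centralizer (C : Set G) := by
    rw [Subgroup.mem_centralizer_iff]
    intro c hc
    have hc' : c ∈ Subgroup.centralizer ({n} : Set G) :=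
      (iInf_le (fun m : N => Subgroup.centralizer ({(m : G)} : Set G)) ⟨n, hn⟩) hc
    rw [Subgroup.mem_centralizer_iff] at hc'
    exact (hc' n rfl).symm
  rw [hZ] at hmem
  exact hmem

/-- Variant with a `Finite` instance on the subgroup. [cite: MochizukiAbsTopI2012, §0 p.8] -/
theorem eq_bot_of_finite_normal_of_isSlimGroup' (hG : IsSlimGroup G) (N : Subgroup G) [N.Normal]
    [Finite N] : N = ⊥ :=
  eq_bot_of_finite_normal_of_isSlimGroup hG N (Set.toFinite _)

/-- Contrapositive form used in [AbsTopI] Thm 1.7 (ii)'s proof ("we may always replace `k` by a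
finite extension"): a NONTRIVIAL normal subgroup of a slim Hausdorff group is infinite.
[cite: MochizukiAbsTopI2012, §0 p.8] -/
theorem infinite_of_normal_ne_bot_of_isSlimGroup (hG : IsSlimGroup G) (N : Subgroup G)
    [N.Normal] (hN : N ≠ ⊥) : (N : Set G).Infinite :=
  fun h => hN (eq_bot_of_finite_normal_of_isSlimGroup hG N h)

end Literature.AnabelianGeometry.AbsoluteAnabelian
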